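import Mathlib.MeasureTheory.Integral.Bochner.Basic
import Mathlib.MeasureTheory.Measure.GiryMonad
import Literature.Probability.Percolation.Z2PivotalMeasure
import Literature.Probability.LatticeModels.DomainDiscretisation
import Literature.Probability.Percolation.QuadCrossingMeasurability
import HarnessLib

/-!
# The averaged pivotal measures of bond-`ℤ²`: locality, measurability, local finiteness, integrals

Topic `Literature/Probability/Percolation`; proofs file next to `Z2PivotalMeasure.lean`
(Garban–Pete–Schramm's isometry-averaged normalised `ε`-important measures
`z2PivotalMeasure ε δ ω = Σ_e pivotalWeight(e, ω) · δ_{midpoint e}` of bond percolation on `δℤ²`,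
C. Garban, G. Pete, O. Schramm, JAMS 26 (2013), arXiv:1008.1378, §4.1 and §1 p. 10; JEMS 20
(2018), arXiv:1305.5526, §2.6).  No named fact is introduced; everything here is structural and
proved:

* `measurable_of_forall_eq_inter` — a function of a random subset that only looks at finitely
  many coordinates is measurable (any target);
* `mem_edgeFourArm_congr_of_inter_eq`, `gridBlock_gridIndex_subset`,
  `exists_finset_pivotalWeight_eq_inter` —
  LOCALITY: the four-arm event of an edge inside a block only looks at the pairs of the block, the
  `3ε`-block of the grid square containing a point lies within `4ε` of it, hence the averaged
  weight of an edge depends on `ω` only through the edges drawn within `4ε` of its midpoint;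
* `measurable_pivotalWeight` — so `ω ↦ pivotalWeight ε δ ω x i` is measurable (`0 < ε`, `0 < δ`;
  no measurability in the grid parameters is needed), and `measurable_z2PivotalMeasure` — the
  kernel `ω ↦ z2PivotalMeasure ε δ ω` is measurable for the Giry `σ`-algebra (GPS 2018 §2.6:
  "`μ^ε` is a measurable map");
* `finite_setOf_edgeMidpoint_mem`, `isFiniteMeasureOnCompacts_z2PivotalMeasure` — local
  finiteness; `integral_z2PivotalMeasure`, `integral_z2PivotalMeasure_eq_sum` —
  `∫ f dμ^ε_δ(ω) = Σ_e w_e(ω) f(mid e)`, a finite sum for compactly supported `f`;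
  `measurable_integral_z2PivotalMeasure` — `ω ↦ ∫ φ dμ^ε_δ(ω)` is measurable for `φ ∈ C_c(ℂ)`
  (which is what makes the convergence clause of `IsZ2PivotalKernelLimit` non-vacuous: its
  Bochner integrands are then a.e.-strongly measurable).

Written for the line `birth` of crux `FlipErgodicityZ2` (route CardyMeckeFlip, items
FlipIdentityZ2 / FlipErgodicityZ2), whose stubs "kernel exists" and "flip identity passes to the
limit" both start from these facts.

## References

* [GarbanPeteSchramm2013Pivotal] C. Garban, G. Pete, O. Schramm, JAMS 26 (2013), arXiv:1008.1378,
  §4.1, §1 p. 10.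
* [GarbanPeteSchramm2018] C. Garban, G. Pete, O. Schramm, JEMS 20 (2018), arXiv:1305.5526, §2.6.
-/

noncomputable section

open Set Filter Metric
open _root_.MeasureTheory _root_.Topology
open scoped ENNReal symmDiff

namespace Literature.Probability.Percolation

open QuadCrossing LatticeModels

/-! ### Locality and measurability of the averaged weight -/

/-- The configurations agreeing with `T` on the finite set of coordinates `F` form an event.
[folklore] -/
theorem measurableSet_setOf_inter_eq {ι : Type*} (F : Finset ι) (T : Set ι) :
    MeasurableSet {ω : Set ι | ω ∩ ↑F = T ∩ ↑F} := by
  have key : {ω : Set ι | ω ∩ ↑F = T ∩ ↑F} = ⋂ i ∈ F, {ω | i ∈ ω ↔ i ∈ T} := by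
    ext ω
    simp only [mem_setOf_eq, mem_iInter, Set.ext_iff, mem_inter_iff, Finset.mem_coe]
    constructor
    · intro h i hi
      have := h i
      tauto
    · intro h i
      constructor
      · rintro ⟨hω, hi⟩
        exact ⟨(h i hi).1 hω, hi⟩
      · rintro ⟨hT, hi⟩
        exact ⟨(h i hi).2 hT, hi⟩
  rw [key]
  refine Finset.measurableSet_biInter F fun i _ => ?_
  by_cases hi : i ∈ T
  · simp only [hi, iff_true]
    exact measurableSet_mem i
  · simp only [hi, iff_false]
    exact (measurableSet_mem i).compl

/-- **A function of a random subset that only looks at finitely many coordinates is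
measurable** (whatever the target): `f ω = f (ω ∩ F)` for a finite `F` makes every fibre a finite
union of cylinder events. [folklore] -/
theorem measurable_of_forall_eq_inter {ι β : Type*} [MeasurableSpace β] (F : Finset ι)
    {f : Set ι → β} (hf : ∀ ω, f ω = f (ω ∩ ↑F)) : Measurable f := by
  classical
  intro B _
  have key : f ⁻¹' B =
      ⋃ T ∈ F.powerset.filter (fun T : Finset ι => f ↑T ∈ B),
        {ω : Set ι | ω ∩ ↑F = ↑T ∩ ↑F} := by
    ext ω
    simp only [mem_preimage, mem_iUnion, Finset.mem_filter, Finset.mem_powerset, mem_setOf_eq,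
      exists_prop]
    constructor
    · intro h
      have e : ω ∩ ↑F = ↑(F.filter (· ∈ ω)) := by
        ext i
        simp only [mem_inter_iff, Finset.mem_coe, Finset.mem_filter]
        tauto
      refine ⟨F.filter (· ∈ ω), ⟨Finset.filter_subset _ _, ?_⟩, ?_⟩
      · rwa [hf, e] at h
      · rw [e]
        exact (inter_eq_left.2 (Finset.coe_subset.2 (Finset.filter_subset _ _))).symm
    · rintro ⟨T, ⟨hTF, hTB⟩, hω⟩
      rw [hf, hω, inter_eq_left.2 (Finset.coe_subset.2 hTF)]
      exact hTB
  rw [key]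
  exact Finset.measurableSet_biUnion _ fun T _ => measurableSet_setOf_inter_eq F ↑T

/-- Configurations agreeing on a set of pairs `K ⊇ S.sym2` have the same open paths inside `S`
(private: the same statement is a helper of an unrelated Summits file, which Literature cannot
import). [folklore] -/
private theorem mem_openConnIn_congr_of_inter_eq {V : Type*} {S : Set V} {K : Set (Sym2 V)}
    (hK : S.sym2 ⊆ K) {ω ω' : BondConfig V} (h : ω ∩ K = ω' ∩ K) (x y : V) :
    ω ∈ openConnIn S x y ↔ ω' ∈ openConnIn S x y := by
  have key : (openGraph ω).induce S = (openGraph ω').induce S := by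
    ext u v
    simp only [SimpleGraph.comap_adj, Function.Embedding.coe_subtype, openGraph_adj]
    have hmem : s(u.1, v.1) ∈ K := hK (Set.mk_mem_sym2_iff.2 ⟨u.2, v.2⟩)
    have hiff : s(u.1, v.1) ∈ ω ↔ s(u.1, v.1) ∈ ω' :=
      ⟨fun h1 => ((Set.ext_iff.1 h _).1 ⟨h1, hmem⟩).1,
        fun h1 => ((Set.ext_iff.1 h _).2 ⟨h1, hmem⟩).1⟩
    rw [hiff]
  simp only [openConnIn, mem_setOf_eq, key]

/-- The four-arm event of an edge inside the block `W` only looks at the pairs of `W`.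
[folklore] -/
theorem mem_edgeFourArm_congr_of_inter_eq {W : Set (Site 2)} {K : Set (Sym2 (Site 2))}
    (hK : W.sym2 ⊆ K) {ω ω' : BondConfig (Site 2)} (h : ω ∩ K = ω' ∩ K) (x : Site 2)
    (i : Fin 2) : ω ∈ edgeFourArm W x i ↔ ω' ∈ edgeFourArm W x i := by
  have h' : (ω \ {edgeFrom x i}) ∩ K = (ω' \ {edgeFrom x i}) ∩ K := by
    ext f
    have := Set.ext_iff.1 h f
    simp only [mem_inter_iff, Set.mem_sdiff, mem_singleton_iff] at this ⊢
    tauto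
  simp only [edgeFourArm, mem_setOf_eq, mem_openConnIn_congr_of_inter_eq hK h']

/-- The grid frame is additive. [folklore] -/
theorem gridFrame_sub (θ : ℝ) (s : Bool) (z z' : ℂ) :
    gridFrame θ s z - gridFrame θ s z' = gridFrame θ s (z - z') := by
  cases s <;> simp [gridFrame, mul_sub]

/-- The grid frame is an isometry fixing the origin. [folklore] -/
theorem norm_gridFrame (θ : ℝ) (s : Bool) (z : ℂ) : ‖gridFrame θ s z‖ = ‖z‖ := by
  have hexp : ‖Complex.exp (-(θ * Complex.I))‖ = 1 := by
    have : -((θ : ℂ) * Complex.I) = ((-θ : ℝ) : ℂ) * Complex.I := by push_cast; ring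
    rw [this, Complex.norm_exp_ofReal_mul_I]
  cases s <;> simp [gridFrame, hexp]

/-- Grid coordinates are `ε⁻¹`-scaled isometric coordinates: `‖gc z − gc z'‖ = ‖z − z'‖ / ε`.
[folklore] -/
theorem norm_gridCoord_sub (ε θ : ℝ) (hε : 0 < ε) (s : Bool) (a z z' : ℂ) :
    ‖gridCoord ε θ s a z - gridCoord ε θ s a z'‖ = ‖z - z'‖ / ε := by
  have : gridCoord ε θ s a z - gridCoord ε θ s a z' = gridFrame θ s (z - z') / ε := by
    simp only [gridCoord, ← gridFrame_sub]; ring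
  rw [this, norm_div, norm_gridFrame, Complex.norm_real, Real.norm_eq_abs, abs_of_pos hε]

/-- **The `3ε`-block of the square containing `m` lies within `4ε` of `m`**: every site of
`gridBlock ε θ s a δ (gridIndex ε θ s a m)` is drawn in the closed disc of radius `4ε` about `m`.
[folklore] -/
theorem gridBlock_gridIndex_subset {ε : ℝ} (hε : 0 < ε) (θ : ℝ) (s : Bool) (a : ℂ) (δ : ℝ)
    (m : ℂ) :
    gridBlock ε θ s a δ (gridIndex ε θ s a m) ⊆ meshVertices (closedBall m (4 * ε)) δ := by
  intro v hv
  rw [mem_meshVertices_iff, mem_closedBall, dist_eq_norm]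
  simp only [gridBlock, gridIndex, mem_setOf_eq, mem_Icc] at hv
  obtain ⟨⟨h1, h2⟩, h3, h4⟩ := hv
  set w := gridCoord ε θ s a (meshPoint δ v) with hw
  set c := gridCoord ε θ s a m with hc
  have hf1 := Int.floor_le c.re
  have hf2 := Int.lt_floor_add_one c.re
  have hf3 := Int.floor_le c.im
  have hf4 := Int.lt_floor_add_one c.im
  have hre : |(w - c).re| ≤ 2 := by
    rw [Complex.sub_re, abs_le]; constructor <;> linarith
  have him : |(w - c).im| ≤ 2 := by
    rw [Complex.sub_im, abs_le]; constructor <;> linarith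
  have hwc : ‖w - c‖ ≤ 4 :=
    (Complex.norm_le_abs_re_add_abs_im _).trans (by linarith)
  have key := norm_gridCoord_sub ε θ hε s a (meshPoint δ v) m
  rw [← hw, ← hc] at key
  rw [key, div_le_iff₀ hε] at hwc
  linarith

/-- For every moved grid, `ε`-importance of the edge `s(x, x + eᵢ)` is determined by the pairs
of sites drawn within `4ε` of its midpoint: configurations agreeing on a set of pairs `K`
containing all those pairs are `ε`-important together. [folklore] -/
theorem mem_gridImportant_congr_of_inter_eq {ε : ℝ} (hε : 0 < ε) (θ : ℝ) (s : Bool) (a : ℂ)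
    (δ : ℝ) (x : Site 2) (i : Fin 2) {K : Set (Sym2 (Site 2))}
    (hK : (meshVertices (closedBall (edgeMidpoint δ x i) (4 * ε)) δ).sym2 ⊆ K)
    {ω ω' : BondConfig (Site 2)} (h : ω ∩ K = ω' ∩ K) :
    ω ∈ gridImportant ε θ s a δ x i ↔ ω' ∈ gridImportant ε θ s a δ x i := by
  refine mem_edgeFourArm_congr_of_inter_eq (fun e he => hK ?_) h x i
  induction e using Sym2.ind with
  | h u v =>
    rw [Set.mk_mem_sym2_iff] at he ⊢
    exact ⟨gridBlock_gridIndex_subset hε θ s a δ _ he.1, gridBlock_gridIndex_subset hε θ s a δ _ he.2⟩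

/-- **Locality of the averaged weight**: `pivotalWeight ε δ ω x i` depends on `ω` only through
a finite set of pairs (those drawn within `4ε` of the midpoint; `0 < ε`, `0 < δ`). [folklore] -/
theorem exists_finset_pivotalWeight_eq_inter {ε δ : ℝ} (hε : 0 < ε) (hδ : 0 < δ) (x : Site 2)
    (i : Fin 2) :
    ∃ F : Finset (Sym2 (Site 2)), ∀ ω : BondConfig (Site 2),
      pivotalWeight ε δ ω x i = pivotalWeight ε δ (ω ∩ ↑F) x i := by
  set F : Finset (Sym2 (Site 2)) :=
    (meshVertices_finite (isBounded_closedBall (x := edgeMidpoint δ x i) (r := 4 * ε))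
      hδ).toFinset.sym2 with hF
  have hK : (meshVertices (closedBall (edgeMidpoint δ x i) (4 * ε)) δ).sym2 ⊆ (↑F : Set _) := by
    rw [hF, Finset.coe_sym2, Set.Finite.coe_toFinset]
  refine ⟨F, fun ω => ?_⟩
  have h : ω ∩ ↑F = (ω ∩ ↑F) ∩ ↑F := by rw [inter_assoc, inter_self]
  unfold pivotalWeight
  have h1 : ∀ s : Bool, {q : ℝ × ℝ × ℝ | ω ∈ gridImportant ε q.1 s (gridShift q) δ x i} =
      {q | ω ∩ ↑F ∈ gridImportant ε q.1 s (gridShift q) δ x i} := by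
    intro s
    ext q
    exact mem_gridImportant_congr_of_inter_eq hε q.1 s (gridShift q) δ x i hK h
  rw [h1 false, h1 true]

/-- **The averaged GPS weight of an edge is a measurable function of the configuration**
(`0 < ε`, `0 < δ`): it is determined by finitely many edges. [folklore] -/
theorem measurable_pivotalWeight {ε δ : ℝ} (hε : 0 < ε) (hδ : 0 < δ) (x : Site 2) (i : Fin 2) :
    Measurable fun ω : BondConfig (Site 2) => pivotalWeight ε δ ω x i := by
  obtain ⟨F, hF⟩ := exists_finset_pivotalWeight_eq_inter hε hδ x i
  exact measurable_of_forall_eq_inter F hF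

/-- The real-valued averaged weight is measurable and bounded by the rate `r(δ)`. [folklore] -/
theorem measurable_pivotalWeight_toReal {ε δ : ℝ} (hε : 0 < ε) (hδ : 0 < δ) (x : Site 2)
    (i : Fin 2) : Measurable fun ω : BondConfig (Site 2) => (pivotalWeight ε δ ω x i).toReal :=
  (measurable_pivotalWeight hε hδ x i).ennreal_toReal

/-- `pivotalWeight_toReal_le`: the real-valued averaged weight is at most `r(δ)`. [folklore] -/
theorem pivotalWeight_toReal_le (ε δ : ℝ) (ω : BondConfig (Site 2)) (x : Site 2) (i : Fin 2) :
    (pivotalWeight ε δ ω x i).toReal ≤ pivotalRate δ :=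
  ENNReal.toReal_le_of_le_ofReal (pivotalRate_nonneg δ) (pivotalWeight_le ε δ ω x i)

/-! ### Local finiteness of `μ^ε_δ(ω)` and the integral of a test function -/

/-- The midpoint of a drawn edge is within `δ` of its first endpoint. [folklore] -/
theorem dist_meshPoint_edgeMidpoint_le {δ : ℝ} (hδ : 0 < δ) (x : Site 2) (i : Fin 2) :
    dist (meshPoint δ x) (edgeMidpoint δ x i) ≤ δ := by
  have hadj : (zdGraph 2).Adj x (x + Pi.single i 1) := (zdGraph_adj_iff x _).2 ⟨i, Or.inl rfl⟩
  have h := norm_meshPoint_sub_meshPoint_le_of_adj δ hadj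
  rw [abs_of_pos hδ] at h
  rw [dist_eq_norm, edgeMidpoint]
  have : meshPoint δ x - (meshPoint δ x + meshPoint δ (x + Pi.single i 1)) / 2 =
      -((meshPoint δ (x + Pi.single i 1) - meshPoint δ x) / 2) := by ring
  rw [this, norm_neg, norm_div, Complex.norm_two]
  linarith [norm_nonneg (meshPoint δ (x + Pi.single i 1) - meshPoint δ x)]

/-- **Local finiteness**: for `δ > 0` only finitely many edges of `δℤ²` have their midpoint in a
bounded window. [folklore] -/
theorem finite_setOf_edgeMidpoint_mem {T : Set ℂ} (hT : Bornology.IsBounded T) {δ : ℝ}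
    (hδ : 0 < δ) : {p : Site 2 × Fin 2 | edgeMidpoint δ p.1 p.2 ∈ T}.Finite := by
  refine ((meshVertices_finite (hT.cthickening (δ := δ)) hδ).prod (finite_univ (α := Fin 2))).subset
    ?_
  rintro ⟨x, i⟩ hx
  refine ⟨?_, mem_univ _⟩
  rw [mem_meshVertices_iff]
  exact mem_cthickening_of_dist_le _ (edgeMidpoint δ x i) _ _ hx
    (dist_meshPoint_edgeMidpoint_le hδ x i)

/-- **`μ^ε_δ(ω)` is finite on compact sets** (`δ > 0`): a compact window contains finitely many
midpoints, each of weight at most `r(δ) < ∞`. [folklore] -/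
theorem isFiniteMeasureOnCompacts_z2PivotalMeasure (ε : ℝ) {δ : ℝ} (hδ : 0 < δ)
    (ω : BondConfig (Site 2)) : IsFiniteMeasureOnCompacts (z2PivotalMeasure ε δ ω) := by
  refine ⟨fun K hK => ?_⟩
  have hfin := finite_setOf_edgeMidpoint_mem hK.isBounded hδ
  rw [z2PivotalMeasure_apply]
  rw [tsum_eq_sum (s := hfin.toFinset) (fun p hp => by
    have hp' : edgeMidpoint δ p.1 p.2 ∉ K := fun h => hp (hfin.mem_toFinset.2 h)
    simp [indicator_of_notMem hp'])]
  refine ENNReal.sum_lt_top.2 fun p _ => ?_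
  calc pivotalWeight ε δ ω p.1 p.2 * K.indicator 1 (edgeMidpoint δ p.1 p.2)
      ≤ pivotalWeight ε δ ω p.1 p.2 * 1 := by
        gcongr
        by_cases h : edgeMidpoint δ p.1 p.2 ∈ K <;> simp [h]
    _ ≤ ENNReal.ofReal (pivotalRate δ) := by rw [mul_one]; exact pivotalWeight_le ε δ ω p.1 p.2
    _ < ⊤ := ENNReal.ofReal_lt_top

/-- **Integration against `μ^ε_δ(ω)`**: for an integrable `f`,
`∫ f dμ^ε_δ(ω) = Σ'_e w_e(ω) f(mid e)`. [folklore] -/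
theorem integral_z2PivotalMeasure (ε δ : ℝ) (ω : BondConfig (Site 2)) {f : ℂ → ℝ}
    (hf : Integrable f (z2PivotalMeasure ε δ ω)) :
    ∫ z, f z ∂(z2PivotalMeasure ε δ ω) =
      ∑' p : Site 2 × Fin 2, (pivotalWeight ε δ ω p.1 p.2).toReal * f (edgeMidpoint δ p.1 p.2) := by
  unfold z2PivotalMeasure at hf ⊢
  rw [integral_sum_measure hf]
  refine tsum_congr fun p => ?_
  rw [integral_smul_measure, integral_dirac, smul_eq_mul]

/-- **Integration of a compactly supported test function against `μ^ε_δ(ω)` is a finite sum**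
over any finite set of edges containing those whose midpoint `f` charges. [folklore] -/
theorem integral_z2PivotalMeasure_eq_sum (ε : ℝ) {δ : ℝ} (hδ : 0 < δ) (ω : BondConfig (Site 2))
    {f : ℂ → ℝ} (hf : Continuous f) (hfc : HasCompactSupport f) (E : Finset (Site 2 × Fin 2))
    (hE : ∀ p : Site 2 × Fin 2, f (edgeMidpoint δ p.1 p.2) ≠ 0 → p ∈ E) :
    ∫ z, f z ∂(z2PivotalMeasure ε δ ω) =
      ∑ p ∈ E, (pivotalWeight ε δ ω p.1 p.2).toReal * f (edgeMidpoint δ p.1 p.2) := by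
  haveI := isFiniteMeasureOnCompacts_z2PivotalMeasure ε hδ ω
  rw [integral_z2PivotalMeasure ε δ ω (hf.integrable_of_hasCompactSupport hfc)]
  refine tsum_eq_sum fun p hp => ?_
  have : f (edgeMidpoint δ p.1 p.2) = 0 := by
    by_contra h
    exact hp (hE p h)
  rw [this, mul_zero]

/-- The edges charged by a compactly supported test function form a finite set. [folklore] -/
theorem exists_finset_of_hasCompactSupport {δ : ℝ} (hδ : 0 < δ) {f : ℂ → ℝ}
    (hfc : HasCompactSupport f) :
    ∃ E : Finset (Site 2 × Fin 2), ∀ p : Site 2 × Fin 2, f (edgeMidpoint δ p.1 p.2) ≠ 0 → p ∈ E := by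
  have hfin := finite_setOf_edgeMidpoint_mem (T := tsupport f) hfc.isCompact.isBounded hδ
  refine ⟨hfin.toFinset, fun p hp => hfin.mem_toFinset.2 ?_⟩
  exact subset_tsupport f (Function.mem_support.2 hp)

/-! ### Measurability of the kernel `ω ↦ μ^ε_δ(ω)` and of its integrals -/

/-- **The averaged pivotal measure is a measurable kernel** (`0 < ε`, `0 < δ`): `ω ↦ μ^ε_δ(ω)`
is measurable for the Giry `σ`-algebra on `Measure ℂ`, each `ω ↦ μ^ε_δ(ω)(s)` being a countable
sum of measurable weights (the lattice-level form of GPS's "`μ^ε` is a measurable map").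
[folklore] -/
theorem measurable_z2PivotalMeasure {ε δ : ℝ} (hε : 0 < ε) (hδ : 0 < δ) :
    Measurable fun ω : BondConfig (Site 2) => z2PivotalMeasure ε δ ω := by
  refine Measure.measurable_of_measurable_coe _ fun s _ => ?_
  simp_rw [z2PivotalMeasure_apply]
  exact Measurable.tsum fun p => (measurable_pivotalWeight hε hδ p.1 p.2).mul_const _

/-- **`ω ↦ ∫ φ dμ^ε_δ(ω)` is measurable** for a continuous compactly supported `φ` (`0 < ε`,
`0 < δ`): it is a finite sum of measurable weights.  This is what makes the Bochner integrands of
the convergence clause of `IsZ2PivotalKernelLimit` a.e.-strongly measurable (non-vacuous).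
[folklore] -/
theorem measurable_integral_z2PivotalMeasure {ε δ : ℝ} (hε : 0 < ε) (hδ : 0 < δ) {φ : ℂ → ℝ}
    (hφ : Continuous φ) (hφc : HasCompactSupport φ) :
    Measurable fun ω : BondConfig (Site 2) => ∫ z, φ z ∂(z2PivotalMeasure ε δ ω) := by
  obtain ⟨E, hE⟩ := exists_finset_of_hasCompactSupport hδ hφc
  have key : (fun ω : BondConfig (Site 2) => ∫ z, φ z ∂(z2PivotalMeasure ε δ ω)) = fun ω =>
      ∑ p ∈ E, (pivotalWeight ε δ ω p.1 p.2).toReal * φ (edgeMidpoint δ p.1 p.2) :=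
    funext fun ω => integral_z2PivotalMeasure_eq_sum ε hδ ω hφ hφc E hE
  rw [key]
  exact Finset.measurable_sum E fun p _ =>
    (measurable_pivotalWeight_toReal hε hδ p.1 p.2).mul_const _

/-- The finite family of integrals `ω ↦ (∫ φⱼ dμ^ε_δ(ω))ⱼ` of continuous compactly supported test
functions is measurable (the vector fed to the test functions `F` of `IsZ2PivotalKernelLimit`).
[folklore] -/
theorem measurable_pi_integral_z2PivotalMeasure {ε δ : ℝ} (hε : 0 < ε) (hδ : 0 < δ) {m : ℕ}
    {φ : Fin m → ℂ → ℝ} (hφ : ∀ j, Continuous (φ j)) (hφc : ∀ j, HasCompactSupport (φ j)) :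
    Measurable fun (ω : BondConfig (Site 2)) (j : Fin m) => ∫ z, φ j z ∂(z2PivotalMeasure ε δ ω) :=
  measurable_pi_lambda _ fun j => measurable_integral_z2PivotalMeasure hε hδ (hφ j) (hφc j)

end Literature.Probability.Percolation

end
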